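import Summits.BirchSwinnertonDyer.BirchSwinnertonDyer.Theorems.ManinLocalTwoThreeManinPrimeToAdditiveFiveLeLedgerFourPrints
import HarnessLib

/-!
# Route `ManinLocalTwoThree`, residual crux C5 `ManinPrimeToAdditiveFiveLe`
# (stmt-BirchSwinnertonDyer-22969), line `upper_anchor` (skeleton of record v13 c7651294ee96133f, the SINGLE TFMD BOOK):
# **the single-book ledger on FIVE prints — Cremona's table and Česnavičius–Neururer–Saha leave it too**

Extra width seat bsd-line-ml23-c5-p1-w4 (gen 2), piece ρ, part 3/3. The LEAD (gen 7) registered v13 = the single TFMD book: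
`stub_printedInputs` [7 cite-only: F″, ČNS, Cremona ≤ 5·10⁵, EdK, EdG, MazurJ, D–D] / ss57 (27071) / ord57 (27552) /
strongIsUnstarred57 (27072) / notBottom13 (C1, 25939) / strongIsTop13 (C2, 26929), composition = ψ §4
`maninPrimeToAdditiveFiveLe_of_sevenPrints_of_twistFamilyItems` (p633601). Parts 1/2 and 2/2 (p635362, p636120) removed
Cremona and ČNS from the E-imc-9(13) book; part 1/2 §2 removed Cremona from the single book. This file removes ČNS from the
single book as well: the TFMD core `EisensteinTrichotomy.not_dvd_c_of_notBottom_of_strongIsTop` (pub/bsd-wall, p621027's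
engine) has NO degree binder, so RED(13)′ (part 2/2's degree-free, level-free shape) follows from C1 ∧ C2 ∧ EdK ∧ D–D, and
part 2/2's ČNS-free stub 2 `reducibleTwistMinimal_of_edixhoven_mazurJ_of_cores` assembles C5.

* §1 `coreRED13'_of_notBottom_of_strongIsTop` — RED(13)′ ⟸ C1 (25939) ∧ C2 (26929) ∧ EdK ∧ D–D (wrapper, binders reordered).
* §2 `maninPrimeToAdditiveFiveLe_of_fivePrints_dokchitser_of_twistFamilyItems` — **C5 BY NAME ⟸ FIVE cite-only prints
  {Kato F″, Edixhoven 1991 Thm. 3 (Kodaira half, ordinarity half), Mazur 1978 Thm. 1, Dokchitser–Dokchitser 2015 Thm. 5.1 (1)}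
  ∧ 27071 ∧ 27552 ∧ 27072 ∧ 25939 ∧ 26929** — the v13 composition with ČNS and Cremona dropped (kernel audit:
  `proof.conditional` on exactly these five Literature facts). For a v14 of the single book: `stub_printedInputs` := these
  five conjuncts; composition := this theorem (candidate attached as evidence; the lead decides).

HONEST STATUS: conditional results (`--supports … --as helper`) on OPEN items 27071 / 27552 / 27072 / 25939 / 26929 and
cite-only prints; nothing here proves C5, any TFMD item, Manin's conjecture or BSD.

References: [EdixhovenManin1991] Thm. 3, §4; [Mazur1978] Thm. 1; [Kato2004Asterisque] (8.1.3), Thm. 9.7;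
[DokchitserDokchitser2015LocalInvariants] Thm. 5.1 (1); [Stevens1989] (5.2), (5.4).
-/

set_option autoImplicit false
-- the Theorems namespace of this sub repeats the summit name by design (D-0017 nested layout)
set_option linter.dupNamespace false

noncomputable section

open scoped Classical NumberField

namespace Summit.BirchSwinnertonDyer.BirchSwinnertonDyer.Theorems

open WeierstrassCurve IsDedekindDomain IsDedekindDomain.HeightOneSpectrum Rat.HeightOneSpectrum NumberField
  Literature.NumberTheory.EllipticCurves Literature.NumberTheory.EllipticCurves.ModularForms
  Literature.NumberTheory.EllipticCurves.Rank1Residual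
  Summit.BirchSwinnertonDyer.Rank1Residual
  Summit.BirchSwinnertonDyer.Rank1Residual.ManinAdditive
  Summit.BirchSwinnertonDyer.Rank1Residual.Additive

/-! ## §1 RED(13)′ from TFMD's C1 ∧ C2 (no degree, no level binder) -/

/-- **RED(13)′ (part 2/2's shape: no `13 ∣ deg φ`, no `N > 5·10⁵`) ⟸ C1 `EisensteinOrdinaryTwistLatticeNotBottom` (stmt-25939)
∧ C2 `EisensteinOrdinaryStrongIsTop` (stmt-26929) ∧ Edixhoven 1991 Thm. 3 Kodaira half ∧ Dokchitser–Dokchitser rigidity** — a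
re-keying of pub/bsd-wall's `coreRED13_of_notBottom_of_strongIsTop` (p621027) on its degree-free engine
`EisensteinTrichotomy.not_dvd_c_of_notBottom_of_strongIsTop`; twist-minimality and reducibility binders carried, not used.
Conditional result; closes nothing. [cite: EdixhovenManin1991, Thm. 3 and §4] [cite: DokchitserDokchitser2015LocalInvariants, Thm. 5.1 (1)] -/
theorem coreRED13'_of_notBottom_of_strongIsTop
    (hC1 : Summit.BirchSwinnertonDyer.BirchSwinnertonDyer.Theses.TwistFamilyManinDescent.EisensteinOrdinaryTwistLatticeNotBottom)
    (hC2 : Summit.BirchSwinnertonDyer.BirchSwinnertonDyer.Theses.TwistFamilyManinDescent.EisensteinOrdinaryStrongIsTop)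
    (hEdK : edixhoven_not_dvd_maninConstant_of_kodairaSymbol_ne)
    (hDD : dokchitser_padicValInt_minimalDiscriminantInt_eq_of_isogeny_of_potentiallyGoodOrdinary) :
    mazur_not_dvd_maninConstant_of_odd → abbesUllmo_not_dvd_maninConstant_of_not_dvd_level →
    cesnavicius_not_two_dvd_maninConstant_of_two_dvd_level → exists_isNewformOf →
    ∀ (W : WeierstrassCurve ℚ) [W.IsElliptic] [W.IsGloballyMinimal] [NeZero (W.conductorNorm ℤ)]
      (D : ModularParametrizationData W (W.conductorNorm ℤ)),
      IsLatticeOptimal D → ∀ p : ℕ, p.Prime → p = 13 → p ^ 2 ∣ W.conductorNorm ℤ →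
      ¬ (∃ (W' : WeierstrassCurve ℚ) (q : ℕ), W'.IsElliptic ∧ W'.IsGloballyMinimal ∧ q.Prime ∧
          q ≠ 2 ∧ q ^ 2 ∣ W.conductorNorm ℤ ∧
          IsIsogenous W (W'.quadraticTwist (((-1 : ℤ) ^ (q / 2) * q : ℤ) : ℚ)) ∧
          ¬ q ^ 2 ∣ W'.conductorNorm ℤ) →
      ¬ (∃ (W' : WeierstrassCurve ℚ) (d : ℤ), W'.IsElliptic ∧ W'.IsGloballyMinimal ∧
          (d = -1 ∨ d = 2 ∨ d = -2) ∧ 2 ^ 2 ∣ W.conductorNorm ℤ ∧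
          IsIsogenous W (W'.quadraticTwist (d : ℚ)) ∧ ¬ 2 ^ 2 ∣ W'.conductorNorm ℤ) →
      ¬ W.HasIrreducibleModPGaloisRep p →
      padicValInt p W.minimalDiscriminantInt ≤ 4 →
      (∃ (L : Type) (_ : Field L) (_ : NumberField L) (_ : IsCyclotomicExtension {p} ℚ L)
          (F : IntermediateField ℚ L),
          ∀ w : HeightOneSpectrum (𝓞 F), (p : 𝓞 F) ∈ w.asIdeal →
            (W.baseChange F).HasGoodReductionAt w ∧ (W.baseChange F).HasUnitRootAt w) →
      ¬ (p : ℤ) ∣ D.maninConstant := by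
  intro _hM _hAU _hC hnf W _ _ _ D hD p hp hp13 hpN _hodd _hdy hred hlow hGo
  haveI : Fact p.Prime := ⟨hp⟩
  exact TwistFamilyManinDescent.EisensteinTrichotomy.not_dvd_c_of_notBottom_of_strongIsTop
    hnf hC1 hC2 hEdK hDD W p D hpN hp13 hred hGo hlow hD

/-! ## §2 The single TFMD book on five prints -/

/-- **Crux C5 `ManinLocalTwoThree.ManinPrimeToAdditiveFiveLe` BY NAME ⟸ FIVE cite-only prints {Kato F″, Edixhoven 1991 Thm. 3
(Kodaira half `hEdK`, ordinarity half `hEdG`), Mazur 1978 Thm. 1 (`hJ`), Dokchitser–Dokchitser 2015 Thm. 5.1 (1) (`hDD`)} ∧ K15b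
(stmt-27071) ∧ `OrdinaryCornerManinResidual` (stmt-27552) ∧ K15a (stmt-27072) ∧ C1 (stmt-25939) ∧ C2 (stmt-26929)** — the
registered v13 composition (ψ §4, p633601) with Česnavičius–Neururer–Saha AND Cremona's table dropped: irreducible locus
`coreKP_of_kato` (modularity ∧ F″); reducible residual = part 2/2's ČNS-free stub 2 over part 1/2's uncut RED(57) and §1.
Conditional result (`--supports`, helper): every open input is a registered TFMD item; C5 is NOT proved; Manin's conjecture
and BSD are not proved. [cite: Kato2004Asterisque, (8.1.3) and Thm. 9.7] [cite: EdixhovenManin1991, Thm. 3] [cite: Mazur1978, Thm. 1]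
[cite: DokchitserDokchitser2015LocalInvariants, Thm. 5.1 (1)] -/
theorem maninPrimeToAdditiveFiveLe_of_fivePrints_dokchitser_of_twistFamilyItems
    (hK57 : kato_neron_isIntegral_twistedSymbolSum_of_additive_five_le)
    (hEdK : edixhoven_not_dvd_maninConstant_of_kodairaSymbol_ne)
    (hEdG : edixhoven_not_dvd_maninConstant_of_not_potentiallyGoodOrdinary)
    (hJ : mazur_j_mem_of_not_hasIrreducibleModPGaloisRep_of_eleven_le)
    (hDD : dokchitser_padicValInt_minimalDiscriminantInt_eq_of_isogeny_of_potentiallyGoodOrdinary)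
    (hK15b : Summit.BirchSwinnertonDyer.BirchSwinnertonDyer.Theses.TwistFamilyManinDescent.SupersingularUnstarredStrongManinUnit)
    (hOrd : Summit.BirchSwinnertonDyer.BirchSwinnertonDyer.Theses.TwistFamilyManinDescent.OrdinaryCornerManinResidual)
    (hK15a : Summit.BirchSwinnertonDyer.BirchSwinnertonDyer.Theses.TwistFamilyManinDescent.SupersingularStrongIsUnstarred)
    (hC1 : Summit.BirchSwinnertonDyer.BirchSwinnertonDyer.Theses.TwistFamilyManinDescent.EisensteinOrdinaryTwistLatticeNotBottom)
    (hC2 : Summit.BirchSwinnertonDyer.BirchSwinnertonDyer.Theses.TwistFamilyManinDescent.EisensteinOrdinaryStrongIsTop) :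
    Summit.BirchSwinnertonDyer.BirchSwinnertonDyer.Theses.ManinLocalTwoThree.ManinPrimeToAdditiveFiveLe := by
  intro hM hAU hC hnf
  exact maninLocalTwoThree_maninPrimeToAdditiveFiveLe_of_kato57_of_cores hK57 (coreKP_of_kato hnf hK57)
    (reducibleTwistMinimal_of_edixhoven_mazurJ_of_cores hEdK hEdG hJ (coreRED57_of_twistFamilyItems hK15b hOrd hK15a)
      (coreRED13'_of_notBottom_of_strongIsTop hC1 hC2 hEdK hDD)) hM hAU hC hnf

end Summit.BirchSwinnertonDyer.BirchSwinnertonDyer.Theorems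

end
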